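import Summits.FinalStateConjecture.FinalStateConjecture.Theorems.SoloBlindGenericity

/-!
# Solo (blind) — robustly exceptional data refute the summit; the weighted-distance instance

The typed final state conjecture asserts that non-settling admissible vacuum data
(`¬ SoloBlindSettles Σ d`) form a set of tame codimension `≥ 1`: through every exceptional datum
passes an admissible `1`-parameter family, tame on an end and immersed at `0`, all of whose other
members settle. This file records the ASSEMBLY OF THE NEGATIVE SIDE in the kernel: what a global
theorem exhibiting a ROBUST exceptional phenomenon must deliver in order to refute the typed
statement.

* `soloBlind_not_statement_of_robust`: one admissible `Σ`, one admissible non-settling datum `d`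
  such that along EVERY admissible tame immersed `1`-parameter family `F` through `d` the
  non-settling parameters accumulate at `0` (`∃ᶠ c in 𝓝[≠] 0, ¬ SoloBlindSettles Σ (F c)`) —
  refutes `FinalStateConjecture`. (`soloBlind_not_statement_of_eventually`: the same with the
  stronger "family-open" hypothesis `∀ᶠ c in 𝓝 0`.)
* `soloBlind_eventually_not_settles_of_control`: family-openness follows from openness of the
  exceptional set in ANY "control" `Φ e : data → T` along which tame admissible families are
  continuous at the base parameter (abstract form; the intended instances are jets on a compact
  core and the weighted distance on the end).
* `soloBlind_eventually_not_settles_of_wDist`, `soloBlind_not_statement_of_wDist_ball`: the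
  instance built into the typing — a tame family is continuous at `0` in the Dafermos–Rodnianski
  weighted `C² × C¹` distance `AFEnd.wDist` of its end, so an admissible non-settling datum `d` with,
  for every sole-end structure `e`, a `wDist`-ball `{d' ∈ 𝒜(Σ) | e.wDist d' d < ε}` of non-settling
  data refutes the summit. CAVEAT (recorded, not a defect): `wDist` reads only the chart region
  `‖x‖ > e.R` of the end, so such a ball contains data with arbitrary compact core; no expected
  exceptional mechanism (naked-singularity formation, non-Kerr asymptotics of the domain of outer
  communication) is decided by the end alone — realistic refutations need the control form with a
  core component.

References: D. Christodoulou, CQG 16 (1999) A23–A35, p. A24; Ann. Math. 149 (1999) 183–217,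
p. 187 (codimension via families `α₀ + c f`); M. Dafermos, I. Rodnianski, arXiv:0811.0354,
App. B.2.3 (the weighted class).
-/

noncomputable section

set_option linter.dupNamespace false

open Literature.Geometry.Lorentzian Set Metric Filter
open scoped Manifold ContDiff Topology ENNReal

namespace Summit.FinalStateConjecture.FinalStateConjecture.Theorems

variable {X : Type} [TopologicalSpace X] [ChartedSpace E3 X] [IsManifold (𝓡 3) ∞ X]
  [T2Space X] [SecondCountableTopology X] [ConnectedSpace X]

/-! ### Robustly exceptional data refute the summit -/

/-- **A family-robustly exceptional admissible datum refutes the final state conjecture.** If some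
admissible `Σ` carries an admissible vacuum datum `d` which does not settle, and along EVERY
admissible `1`-parameter family through `d` that is tame on an end and immersed at `0` the
non-settling parameters accumulate at `0`, then `FinalStateConjecture` fails. [folklore] -/
theorem soloBlind_not_statement_of_robust {d : InitialDataSet (𝓡 3) X}
    (hd : d ∈ admissibleVacuumData X) (hP : ¬ SoloBlindSettles X d)
    (hrob : ∀ (e : AFEnd X) (F : EuclideanSpace ℝ (Fin 1) → InitialDataSet (𝓡 3) X),
      InitialDataSet.IsTameDataFamily e 1 F → InitialDataSet.IsImmersedAtZero 1 F → F 0 = d →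
        (∀ c, F c ∈ admissibleVacuumData X) →
          ∃ᶠ c in 𝓝[≠] (0 : EuclideanSpace ℝ (Fin 1)), ¬ SoloBlindSettles X (F c)) :
    ¬ FinalStateConjecture := by
  intro h
  obtain ⟨e, F, hF, hI, h0, -, hD, hE⟩ := h X d ⟨hd, hP⟩
  have hev : ∀ᶠ c in 𝓝[≠] (0 : EuclideanSpace ℝ (Fin 1)), SoloBlindSettles X (F c) := by
    refine eventually_nhdsWithin_of_forall fun c hc ↦ ?_
    have hc' : F c ∉ {d ∈ admissibleVacuumData X | ¬ SoloBlindSettles X d} := hE c hc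
    simp only [mem_setOf_eq, not_and, not_not] at hc'
    exact hc' (hD c)
  obtain ⟨c, hcP, hc⟩ := ((hrob e F hF hI h0 hD).and_eventually hev).exists
  exact hcP hc

/-- **Family-open exceptional data refute the summit** (the stronger, "open" form of
`soloBlind_not_statement_of_robust`: every admissible tame immersed family through `d` consists
of non-settling data for all parameters near `0`). [folklore] -/
theorem soloBlind_not_statement_of_eventually {d : InitialDataSet (𝓡 3) X}
    (hd : d ∈ admissibleVacuumData X) (hP : ¬ SoloBlindSettles X d)
    (hopen : ∀ (e : AFEnd X) (F : EuclideanSpace ℝ (Fin 1) → InitialDataSet (𝓡 3) X),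
      InitialDataSet.IsTameDataFamily e 1 F → InitialDataSet.IsImmersedAtZero 1 F → F 0 = d →
        (∀ c, F c ∈ admissibleVacuumData X) →
          ∀ᶠ c in 𝓝 (0 : EuclideanSpace ℝ (Fin 1)), ¬ SoloBlindSettles X (F c)) :
    ¬ FinalStateConjecture := by
  haveI : NeBot (𝓝[≠] (0 : EuclideanSpace ℝ (Fin 1))) :=
    Module.punctured_nhds_neBot ℝ (EuclideanSpace ℝ (Fin 1)) 0
  refine soloBlind_not_statement_of_robust hd hP fun e F hF hI h0 hD ↦ ?_
  exact ((hopen e F hF hI h0 hD).filter_mono nhdsWithin_le_nhds).frequently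

/-! ### Family-openness from a control functional -/

/-- **Openness of the exceptional set under a control functional gives family-openness.** Let
`Φ e : InitialDataSet (𝓡 3) X → T` be any "control" (it may depend on the end structure `e`)
along which every admissible family tame on `e` is continuous at the base parameter. If the
non-settling admissible data contain the `Φ e`-preimage of a neighbourhood of `Φ e d` for every
`e`, then every admissible tame family through `d` consists of non-settling data near `0`.
Intended instances: jets of `(h, k)` on a compact core together with the weighted distance on
the end. [folklore] -/
theorem soloBlind_eventually_not_settles_of_control {T : AFEnd X → Type*}
    [∀ e, TopologicalSpace (T e)] (Φ : ∀ e : AFEnd X, InitialDataSet (𝓡 3) X → T e)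
    {d : InitialDataSet (𝓡 3) X}
    (hcont : ∀ (e : AFEnd X) (F : EuclideanSpace ℝ (Fin 1) → InitialDataSet (𝓡 3) X),
      InitialDataSet.IsTameDataFamily e 1 F → F 0 = d → (∀ c, F c ∈ admissibleVacuumData X) →
        Tendsto (fun c ↦ Φ e (F c)) (𝓝 0) (𝓝 (Φ e d)))
    (hE : ∀ e : AFEnd X, e.IsSoleEnd → ∃ U ∈ 𝓝 (Φ e d),
      ∀ d' ∈ admissibleVacuumData X, Φ e d' ∈ U → ¬ SoloBlindSettles X d')
    (e : AFEnd X) (F : EuclideanSpace ℝ (Fin 1) → InitialDataSet (𝓡 3) X)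
    (hF : InitialDataSet.IsTameDataFamily e 1 F) (h0 : F 0 = d)
    (hD : ∀ c, F c ∈ admissibleVacuumData X) :
    ∀ᶠ c in 𝓝 (0 : EuclideanSpace ℝ (Fin 1)), ¬ SoloBlindSettles X (F c) := by
  obtain ⟨U, hU, hEU⟩ := hE e hF.2.1
  exact ((hcont e F hF h0 hD).eventually_mem hU).mono fun c hc ↦ hEU (F c) (hD c) hc

/-! ### The instance built into the typing: the weighted distance on the end -/

/-- **A tame family is eventually inside every `wDist`-ball of exceptional data around its base
datum.** If, for every sole-end structure `e` of `Σ`, the admissible data at `e.wDist`-distance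
`< ε` from `d` do not settle, then every admissible family through `d` tame on an end consists of
non-settling data for all parameters near `0` (continuity of tame families at `0` in `wDist`).
[folklore] -/
theorem soloBlind_eventually_not_settles_of_wDist {d : InitialDataSet (𝓡 3) X}
    (hball : ∀ e : AFEnd X, e.IsSoleEnd → ∃ ε : ℝ≥0∞, 0 < ε ∧
      ∀ d' ∈ admissibleVacuumData X, e.wDist d' d < ε → ¬ SoloBlindSettles X d')
    (e : AFEnd X) (F : EuclideanSpace ℝ (Fin 1) → InitialDataSet (𝓡 3) X)
    (hF : InitialDataSet.IsTameDataFamily e 1 F) (h0 : F 0 = d)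
    (hD : ∀ c, F c ∈ admissibleVacuumData X) :
    ∀ᶠ c in 𝓝 (0 : EuclideanSpace ℝ (Fin 1)), ¬ SoloBlindSettles X (F c) := by
  obtain ⟨ε, hε, hEε⟩ := hball e hF.2.1
  have hT : Tendsto (fun c ↦ e.wDist (F c) (F 0)) (𝓝 0) (𝓝 0) := hF.2.2.2
  refine (hT.eventually_mem (Iio_mem_nhds hε)).mono fun c hc ↦ hEε (F c) (hD c) ?_
  rw [← h0]
  exact hc

/-- **An admissible non-settling datum with a `wDist`-ball of non-settling admissible data (for
every sole-end structure) refutes the final state conjecture.** The weighted `C² × C¹` distance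
`AFEnd.wDist` reads only the end (`‖x‖ > e.R` in the end chart); the hypothesis therefore ignores
the compact core of `d'` and is far stronger than what any expected exceptional mechanism would
supply — see `soloBlind_eventually_not_settles_of_control` for the realistic shape. [folklore] -/
theorem soloBlind_not_statement_of_wDist_ball {d : InitialDataSet (𝓡 3) X}
    (hd : d ∈ admissibleVacuumData X) (hP : ¬ SoloBlindSettles X d)
    (hball : ∀ e : AFEnd X, e.IsSoleEnd → ∃ ε : ℝ≥0∞, 0 < ε ∧
      ∀ d' ∈ admissibleVacuumData X, e.wDist d' d < ε → ¬ SoloBlindSettles X d') :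
    ¬ FinalStateConjecture :=
  soloBlind_not_statement_of_eventually hd hP fun e F hF _ h0 hD ↦
    soloBlind_eventually_not_settles_of_wDist hball e F hF h0 hD

/-- **Control form of the refutation.** An admissible non-settling datum `d` whose exceptionality
is open under some control functional continuous along admissible tame families refutes the final
state conjecture. [folklore] -/
theorem soloBlind_not_statement_of_control {T : AFEnd X → Type*}
    [∀ e, TopologicalSpace (T e)] (Φ : ∀ e : AFEnd X, InitialDataSet (𝓡 3) X → T e)
    {d : InitialDataSet (𝓡 3) X} (hd : d ∈ admissibleVacuumData X) (hP : ¬ SoloBlindSettles X d)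
    (hcont : ∀ (e : AFEnd X) (F : EuclideanSpace ℝ (Fin 1) → InitialDataSet (𝓡 3) X),
      InitialDataSet.IsTameDataFamily e 1 F → F 0 = d → (∀ c, F c ∈ admissibleVacuumData X) →
        Tendsto (fun c ↦ Φ e (F c)) (𝓝 0) (𝓝 (Φ e d)))
    (hE : ∀ e : AFEnd X, e.IsSoleEnd → ∃ U ∈ 𝓝 (Φ e d),
      ∀ d' ∈ admissibleVacuumData X, Φ e d' ∈ U → ¬ SoloBlindSettles X d') :
    ¬ FinalStateConjecture :=
  soloBlind_not_statement_of_eventually hd hP fun e F hF _ h0 hD ↦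
    soloBlind_eventually_not_settles_of_control Φ hcont hE e F hF h0 hD

end Summit.FinalStateConjecture.FinalStateConjecture.Theorems

end
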